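/-
Copyright (c) 2026 the pub-hodgecm-mathlib formalisation cell (harness21).  Prover seat hodgecm-mathlib-LH7-p02 (g6): LH4-plan (g7) DEAL (m) = (C5-x) of the LAYER C
(trace-frame) column — the 2-free twin of ★ `UnitOrbitalIntegralInertValueExponents` (A-p03 (g24)); LH3-p02 (g6)'s census `CENSUS-C5-InertCountsValuesTrace.v1` bd72510a
§0.5 (i) ∕ §2 row «ValueExponents» ∕ §6; 2026-09-02.
-/
import Literature.NumberTheory.Rogawski1990.UnitOrbitalIntegralInertValueExponents     -- ★ the TAME dictionary (its frame: `phiOne`, `phiOne_of_le`, `LocalConjDatum` currency) — NOT restated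
import Literature.NumberTheory.Automorphic.UnitaryThreeTorusBlockElementsTrace          -- ★ F1 p851889: `v_eq_one_of_add_map_eq_one` (`b + σb = 1`, `|b| ≤ 1` ⇒ `|b| = |σb| = 1`)
import HarnessLib

/-!
# LAYER C exponent dictionary in the TRACE FRAME: `N₊′ = ord((x − y)·σb + (z − y)·b)` and `phiOne q N₊′ P = phiOne q Q₁ P` — every residue characteristic

Topic `NumberTheory/Rogawski1990` (road «D-N7-inert», LAYER C glue); namespace `Literature.NumberTheory.Automorphic.UnitaryGroup` (as ★).  THEOREMS ONLY (no `def`, no instance,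
no notation, no named fact, no `sorry`); kernel lane `--supports stmt-HodgeConjecture-24833`.  Cell `pub/hodgecm-mathlib` (D-0151), crux H413; LH4-plan (g7) DEAL (m) = census
row (C5-x) «`…ValueExponentsTrace` — any time: pure valuation lemma» of LH3-p02's CENSUS-C5 bd72510a.  HONEST LABEL: HC_CM is proved only modulo the 7 printed citations
(2 remaining named inputs: hLiu418 = stmt-HodgeConjecture-24832, h413 = stmt-HodgeConjecture-24833) until rung 0 closes; count-neutral ((D-UNR) stays PRINT by D74′).

★ `exists_exponent_phiOne_eq (hd : LocalConjDatum σ ϖ)` reads the corner exponent of Flicker's SYMMETRIC torus shape, `N₊ = ord(x + z − 2y) = ord(2(A − y))`, `A = (x+z)∕2`,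
and its proof uses `|2| = 1` three times.  In the TRACE frame (LAYER B tokens T3: `b + σb = 1`, `|b| ≤ 1`; corner `r⁻¹·M(x₁,x₂,x₃)·r` with `(0,0)`-entry
`A = x₁σb + x₃b`) the same invariant is `A − x₂ = (x₁ − x₂)·σb + (x₃ − x₂)·b =: E` — integral for free, no `2` anywhere (census §0.5 (i)).  Writing
`(x, y, z) := (x₁, x₂, x₃)`, `P = ord(x − z)`, `Q₁ = ord(x − y)`, `Q₂ = ord(z − y)`:
* §1 (any valued field, `σ` with `b + σb = 1`): the type-A rewriting **`E = (x − y) + (z − x)·b`** (`traceCorner_eq`), `E = 0 ↔ x − y = (x − z)·b` (`traceCorner_eq_zero_iff`),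
  integrality `|E| ≤ 1` (`v_traceCorner_le_one`).
* §2 (`hd : UnramifiedLocalConjDatum σ ϖ` — NO `v2`): the DICTIONARY **`phiOne_traceExponent_eq`**: if `|E| = |ϖ^{N₊′}|` then `phiOne q N₊′ P = phiOne q Q₁ P` (the ultrametric
  case split of ★ with `|b| = |σb| = 1` from ★ F1: `Q₁ < Q₂ ⇒ N₊′ = Q₁`; `Q₂ < Q₁ ⇒ N₊′ = Q₂ = P ≤ Q₁`; `Q₁ = Q₂ < P ⇒ N₊′ = Q₁` by the type-A form — this is where ★ needed
  `|2(x−y)| = |x−y|`; `Q₁ = Q₂ = P ⇒ N₊′ ≥ P`; ★ `phiOne_of_le`), the ★-shaped head **`exists_traceExponent_phiOne_eq (hE : E ≠ 0)`**, and the DEGENERATE case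
  **`exponents_eq_of_traceCorner_eq_zero`** (`E = 0 ⇒ Q₁ = P ∧ Q₂ = P`) with its reading `phiOne_eq_of_traceCorner_eq_zero` (`E = 0 ⇒ ∀ N ≥ P, phiOne q N P = phiOne q Q₁ P`).
FINDING (census (m), for the (C5)′ heads): in the trace frame regularity `x ≠ z` NO LONGER forces the corner invariant to be non-zero — `E = 0 ⟺ x − y = (x − z)·b`
(for norm-one triples: `y² = xz` and `b = (x−y)∕(x−z)`, whence `Q₁ = Q₂ = P`); ★'s binder `hxz` therefore becomes `hE : E ≠ 0` in the existence head, and the `E = 0`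
triples are served by the degenerate lemma (any `N ≥ P` gives the printed value).  The norm-one hypotheses `hx hy hz` of ★ are not needed at all.

## References
* [Flicker1998UnitaryFL] Y. Z. Flicker, *Elementary proof of the fundamental lemma for a unitary group*, Canad. J. Math. 50 (1998), 74–98: §4 p. 85 (`N₁, N₂, N, N₊`),
  Prop. 11 p. 87.
-/

set_option autoImplicit false

open scoped MatrixGroups WithZero Valued

namespace Literature.NumberTheory.Automorphic

namespace UnitaryGroup

open Literature.NumberTheory.Automorphic.HermitianLattice (UnramifiedLocalConjDatum)
open Literature.NumberTheory.Rogawski1990.Flicker1998 (phiOne phiOne_of_le)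

variable {K : Type*} [Field K] [Valued K ℤᵐ⁰] {ϖ : K} (σ : K →+* K)

/-! ## §1 The trace-frame corner invariant `E = (x − y)·σb + (z − y)·b` — algebra and integrality -/

omit [Valued K ℤᵐ⁰] in
/-- **Type-A rewriting of the corner invariant**: with `b + σb = 1`, `(x − y)·σb + (z − y)·b = (x − y) + (z − x)·b`. [cite: Flicker1998UnitaryFL, §4 p. 85] -/
theorem traceCorner_eq {b : K} (hb : b + σ b = 1) (x y z : K) : (x - y) * σ b + (z - y) * b = (x - y) + (z - x) * b := by
  have hσb : σ b = 1 - b := by rw [← hb]; ring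
  rw [hσb]; ring

omit [Valued K ℤᵐ⁰] in
/-- `E = 0 ↔ x − y = (x − z)·b` (so in the trace frame `x ≠ z` alone does not make the corner invariant non-zero). [cite: Flicker1998UnitaryFL, §4 p. 85] -/
theorem traceCorner_eq_zero_iff {b : K} (hb : b + σ b = 1) (x y z : K) : (x - y) * σ b + (z - y) * b = 0 ↔ x - y = (x - z) * b := by
  rw [traceCorner_eq σ hb]
  constructor
  · intro h; linear_combination h
  · intro h; linear_combination h

/-- **Integrality of the corner invariant**: `|x − y| ≤ 1`, `|z − y| ≤ 1`, `|b| ≤ 1`, `|σb| ≤ 1` ⇒ `|E| ≤ 1`. [cite: Flicker1998UnitaryFL, §4 p. 85] -/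
theorem v_traceCorner_le_one {b x y z : K} (hbv : Valued.v b ≤ 1) (hσbv : Valued.v (σ b) ≤ 1) (hxy : Valued.v (x - y) ≤ 1) (hzy : Valued.v (z - y) ≤ 1) :
    Valued.v ((x - y) * σ b + (z - y) * b) ≤ 1 := by
  refine le_trans (Valuation.map_add _ _ _) (max_le ?_ ?_)
  · rw [map_mul]; exact mul_le_one' hxy hσbv
  · rw [map_mul]; exact mul_le_one' hzy hbv

/-! ## §2 The dictionary `phiOne q N₊′ P = phiOne q Q₁ P` -/

/-- **THE DICTIONARY, given the trace-frame exponent** (`hd : UnramifiedLocalConjDatum`, NO `|2| = 1`): for `x, y, z ∈ K` with `|x − z| = |ϖ^P|`, `|x − y| = |ϖ^{Q₁}|`, `|z − y| = |ϖ^{Q₂}|`,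
a trace element `b` (`b + σb = 1`, `|b| ≤ 1`) and `N₊′` with `|(x − y)·σb + (z − y)·b| = |ϖ^{N₊′}|`: `phiOne q N₊′ P = phiOne q Q₁ P` for every `q`.  The two smallest of `Q₁, Q₂, P`
coincide; `N₊′ = min(Q₁, Q₂)` unless `Q₁ = Q₂ = P` (then `N₊′ ≥ P`), the case `Q₁ = Q₂ < P` being read from the type-A form `E = (x − y) + (z − x)·b` — no `2`.
[cite: Flicker1998UnitaryFL, §4 p. 85, Prop. 11 p. 87] -/
theorem phiOne_traceExponent_eq (hd : UnramifiedLocalConjDatum σ ϖ) {b : K} (hb : b + σ b = 1) (hbv : Valued.v b ≤ 1) {x y z : K} {P Q₁ Q₂ Np : ℕ}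
    (hP : Valued.v (x - z) = Valued.v (ϖ ^ P)) (hQ₁ : Valued.v (x - y) = Valued.v (ϖ ^ Q₁)) (hQ₂ : Valued.v (z - y) = Valued.v (ϖ ^ Q₂))
    (hNp : Valued.v ((x - y) * σ b + (z - y) * b) = Valued.v (ϖ ^ Np)) (q : ℕ) : phiOne q Np P = phiOne q Q₁ P := by
  obtain ⟨hb1, hσb1, -⟩ := v_eq_one_of_add_map_eq_one σ hd.vσ hbv hb
  have es : (x - y) * σ b + (z - y) * b = (x - y) + (z - x) * b := traceCorner_eq σ hb x y z
  have ed : x - z = (x - y) - (z - y) := by ring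
  rcases lt_trichotomy Q₁ Q₂ with hlt | heq | hgt
  · -- `Q₁ < Q₂`: `N₊′ = Q₁`
    have h1 : Valued.v ((x - y) * σ b) = Valued.v (ϖ ^ Q₁) := by rw [map_mul, hσb1, mul_one, hQ₁]
    have h2' : Valued.v ((z - y) * b) = Valued.v (ϖ ^ Q₂) := by rw [map_mul, hb1, mul_one, hQ₂]
    have : Valued.v ((x - y) * σ b + (z - y) * b) = Valued.v (ϖ ^ Q₁) := by
      rw [Valuation.map_add_eq_of_lt_left _ (by rw [h1, h2', hd.v_pow, hd.v_pow, WithZero.exp_lt_exp]; omega), h1]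
    rw [this, hd.v_pow, hd.v_pow, WithZero.exp_inj] at hNp
    rw [show Np = Q₁ by omega]
  · -- `Q₁ = Q₂ =: Q`: `Q ≤ P`; `Q < P ⇒ N₊′ = Q` (type-A form), `Q = P ⇒ N₊′ ≥ P`
    subst heq
    have hPle : Q₁ ≤ P := by
      have h := Valuation.map_sub (Valued.v) (x - y) (z - y)
      rw [← ed, hP, hQ₁, hQ₂, max_self, hd.v_pow, hd.v_pow, WithZero.exp_le_exp] at h; omega
    rcases hPle.lt_or_eq with hlt' | heq'
    · have hsum : Valued.v ((x - y) * σ b + (z - y) * b) = Valued.v (ϖ ^ Q₁) := by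
        have hzx : Valued.v ((z - x) * b) = Valued.v (ϖ ^ P) := by
          rw [map_mul, hb1, mul_one, show z - x = -(x - z) by ring, Valuation.map_neg, hP]
        rw [es, Valuation.map_add_eq_of_lt_left _ (by rw [hQ₁, hzx, hd.v_pow, hd.v_pow, WithZero.exp_lt_exp]; omega), hQ₁]
      rw [hsum, hd.v_pow, hd.v_pow, WithZero.exp_inj] at hNp
      rw [show Np = Q₁ by omega]
    · subst heq'
      have hNpge : Q₁ ≤ Np := by
        have h : Valued.v ((x - y) * σ b + (z - y) * b) ≤ Valued.v (ϖ ^ Q₁) := by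
          refine le_trans (Valuation.map_add _ _ _) (max_le ?_ ?_)
          · rw [map_mul, hσb1, mul_one]; exact hQ₁.le
          · rw [map_mul, hb1, mul_one]; exact hQ₂.le
        rw [hNp, hd.v_pow, hd.v_pow, WithZero.exp_le_exp] at h; omega
      rw [phiOne_of_le q hNpge, phiOne_of_le q le_rfl]
  · -- `Q₂ < Q₁`: `N₊′ = Q₂ = P < Q₁`
    have h1 : Valued.v ((x - y) * σ b) = Valued.v (ϖ ^ Q₁) := by rw [map_mul, hσb1, mul_one, hQ₁]
    have h2' : Valued.v ((z - y) * b) = Valued.v (ϖ ^ Q₂) := by rw [map_mul, hb1, mul_one, hQ₂]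
    have hsum : Valued.v ((x - y) * σ b + (z - y) * b) = Valued.v (ϖ ^ Q₂) := by
      rw [Valuation.map_add_eq_of_lt_right _ (by rw [h1, h2', hd.v_pow, hd.v_pow, WithZero.exp_lt_exp]; omega), h2']
    have hdiff : Valued.v (x - z) = Valued.v (ϖ ^ Q₂) := by
      rw [show x - z = (x - y) + (-(z - y)) by ring,
        Valuation.map_add_eq_of_lt_right _ (by rw [Valuation.map_neg, hQ₁, hQ₂, hd.v_pow, hd.v_pow, WithZero.exp_lt_exp]; omega),
        Valuation.map_neg, hQ₂]
    rw [hsum, hd.v_pow, hd.v_pow, WithZero.exp_inj] at hNp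
    rw [hdiff, hd.v_pow, hd.v_pow, WithZero.exp_inj] at hP
    have hNpP : Np = P := by omega
    rw [hNpP, phiOne_of_le q le_rfl, phiOne_of_le q (by omega : P ≤ Q₁)]

/-- **THE TRACE-FRAME EXPONENT `N₊′` AND THE VALUE DICTIONARY** (★ `exists_exponent_phiOne_eq` with `hd : LocalConjDatum ↦ UnramifiedLocalConjDatum`, `hx hy hz` DROPPED,
`hxz : x ≠ z ↦ hE : E ≠ 0`, `x + z − 2y ↦ (x − y)·σb + (z − y)·b`): for `x, y, z` with `|x − z| = |ϖ^P|`, `|x − y| = |ϖ^{Q₁}|`, `|z − y| = |ϖ^{Q₂}|`, a trace element `b`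
(`b + σb = 1`, `|b| ≤ 1`) and `E := (x − y)·σb + (z − y)·b ≠ 0`, there is `N₊′` with `|E| = |ϖ^{N₊′}|` and `phiOne q N₊′ P = phiOne q Q₁ P`.  Every residue characteristic.
[cite: Flicker1998UnitaryFL, §4 p. 85, Prop. 11 p. 87] -/
theorem exists_traceExponent_phiOne_eq (hd : UnramifiedLocalConjDatum σ ϖ) {b : K} (hb : b + σ b = 1) (hbv : Valued.v b ≤ 1) {x y z : K}
    (hE : (x - y) * σ b + (z - y) * b ≠ 0) {P Q₁ Q₂ : ℕ} (hP : Valued.v (x - z) = Valued.v (ϖ ^ P)) (hQ₁ : Valued.v (x - y) = Valued.v (ϖ ^ Q₁))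
    (hQ₂ : Valued.v (z - y) = Valued.v (ϖ ^ Q₂)) :
    ∃ Np : ℕ, Valued.v ((x - y) * σ b + (z - y) * b) = Valued.v (ϖ ^ Np) ∧ ∀ q : ℕ, phiOne q Np P = phiOne q Q₁ P := by
  obtain ⟨hb1, hσb1, -⟩ := v_eq_one_of_add_map_eq_one σ hd.vσ hbv hb
  have hle : Valued.v ((x - y) * σ b + (z - y) * b) ≤ 1 :=
    v_traceCorner_le_one σ hbv hσb1.le (by rw [hQ₁]; exact hd.v_pow_le_one Q₁) (by rw [hQ₂]; exact hd.v_pow_le_one Q₂)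
  obtain ⟨Np, hNp⟩ : ∃ Np : ℕ, Valued.v ((x - y) * σ b + (z - y) * b) = Valued.v (ϖ ^ Np) := by
    have hv0 : Valued.v ((x - y) * σ b + (z - y) * b) ≠ 0 := (Valuation.ne_zero_iff _).2 hE
    obtain ⟨k, hk⟩ : ∃ k : ℤ, Valued.v ((x - y) * σ b + (z - y) * b) = WithZero.exp k := ⟨_, (WithZero.exp_log hv0).symm⟩
    have hk0 : k ≤ 0 := by rw [hk, ← WithZero.exp_zero, WithZero.exp_le_exp] at hle; exact hle
    refine ⟨k.natAbs, ?_⟩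
    rw [hk, hd.v_pow]; congr 1; omega
  exact ⟨Np, hNp, fun q => phiOne_traceExponent_eq σ hd hb hbv hP hQ₁ hQ₂ hNp q⟩

/-- **THE DEGENERATE CASE `E = 0`: then `Q₁ = P` and `Q₂ = P`** (`E = (x − y) + (z − x)·b` with `|b| = 1` forces `|x − y| = |x − z|`; symmetrically in `σb`).
[cite: Flicker1998UnitaryFL, §4 p. 85] -/
theorem exponents_eq_of_traceCorner_eq_zero (hd : UnramifiedLocalConjDatum σ ϖ) {b : K} (hb : b + σ b = 1) (hbv : Valued.v b ≤ 1) {x y z : K}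
    (hE0 : (x - y) * σ b + (z - y) * b = 0) {P Q₁ Q₂ : ℕ} (hP : Valued.v (x - z) = Valued.v (ϖ ^ P)) (hQ₁ : Valued.v (x - y) = Valued.v (ϖ ^ Q₁))
    (hQ₂ : Valued.v (z - y) = Valued.v (ϖ ^ Q₂)) : Q₁ = P ∧ Q₂ = P := by
  obtain ⟨hb1, hσb1, -⟩ := v_eq_one_of_add_map_eq_one σ hd.vσ hbv hb
  -- `x − y = (x − z)·b` and `z − y = (z − x)·σb`
  have h1 : x - y = (x - z) * b := (traceCorner_eq_zero_iff σ hb x y z).1 hE0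
  have h2' : z - y = (z - x) * σ b := by
    have hσb : σ b = 1 - b := by rw [← hb]; ring
    rw [hσb]; linear_combination h1
  have hQ₁P : Valued.v (ϖ ^ Q₁) = Valued.v (ϖ ^ P) := by rw [← hQ₁, h1, map_mul, hb1, mul_one, hP]
  have hQ₂P : Valued.v (ϖ ^ Q₂) = Valued.v (ϖ ^ P) := by
    rw [← hQ₂, h2', map_mul, hσb1, mul_one, show z - x = -(x - z) by ring, Valuation.map_neg, hP]
  rw [hd.v_pow, hd.v_pow, WithZero.exp_inj] at hQ₁P hQ₂P
  exact ⟨by omega, by omega⟩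

/-- **Reading of the degenerate case**: if `E = 0` then for EVERY `N ≥ P`, `phiOne q N P = phiOne q Q₁ P` (both are the `P ≤ ·` branch of ★ `phiOne`, since `Q₁ = P`) — so a (C5)′
consumer may take any `N₊′ ≥ P` there. [cite: Flicker1998UnitaryFL, Prop. 11 p. 87] -/
theorem phiOne_eq_of_traceCorner_eq_zero (hd : UnramifiedLocalConjDatum σ ϖ) {b : K} (hb : b + σ b = 1) (hbv : Valued.v b ≤ 1) {x y z : K}
    (hE0 : (x - y) * σ b + (z - y) * b = 0) {P Q₁ Q₂ : ℕ} (hP : Valued.v (x - z) = Valued.v (ϖ ^ P)) (hQ₁ : Valued.v (x - y) = Valued.v (ϖ ^ Q₁))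
    (hQ₂ : Valued.v (z - y) = Valued.v (ϖ ^ Q₂)) {N : ℕ} (hN : P ≤ N) (q : ℕ) : phiOne q N P = phiOne q Q₁ P := by
  obtain ⟨hQ₁P, -⟩ := exponents_eq_of_traceCorner_eq_zero σ hd hb hbv hE0 hP hQ₁ hQ₂
  rw [phiOne_of_le q hN, hQ₁P, phiOne_of_le q le_rfl]

end UnitaryGroup

end Literature.NumberTheory.Automorphic
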